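import Summits.QuantumAdvantage.QuantumAdvantage.Theorems.CylinderDialPieces

/-!
# CylinderDial, part 2/4: the EXACT SPLIT `PureCover3 ↔ KCover3 K ∧ KBridge3 K` (every class `K`) and the cylinder BRIDGE (support for item stmt-QuantumAdvantage-30910)

Land port of §4 of the node «CylinderDial» (cell decomp-qadv, lens-5, g13).
* `spreadLossK3_of_cylTameK3 K : CylTameK3 K → CylAlgSpread3 → SpreadLossK3 K` — cylinder tameness of class-`K` systems (victim-free)
  + algebraic spread relative to cylinders (one modulus) ⟹ foreign spread against class `K` (fibre summation over disjoint good
  cylinders; `budget`).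
* `pureCover3_iff_kPieces K` (pure logic + tree `SteerDial.polyLoss3_of_algSpread3_item`); `pureCover3_iff_jPieces`; `jCover3_of_pieces`;
  `closes : PolyLoss3 → AlgCover3 → CylTameJ3 → CylCover3 → JBridge3 → AdviceFreeQNC0Three` (leaf BY NAME, rung currency only; via tree
  `spreadDial_closes₂`, `SteerDial.coverSplitGlue3`); `closes_naive` (the general law, 4 binders).
No `sorry`, no new axioms, no instances, no notation.
-/

set_option linter.style.longLine false
set_option linter.dupNamespace false

noncomputable section
open scoped Classical

namespace Summit.QuantumAdvantage.QuantumAdvantage.Theorems.CylinderDial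

open Finset
open Literature.Computability.QuantumComplexity Literature.Computability.QuantumComplexity.RingHLF
open Literature.Computability.MetaComplexity
open Summit.QuantumAdvantage.AdviceFreeQNC0
open Summit.QuantumAdvantage.QuantumAdvantage.Theses

/-! ## §4  The bridge (PROVED): cylinder tameness + relative spread on cylinders ⟹ foreign spread -/

section Bridge

/-- bookkeeping: `1/n^(j+k+1)·2ⁿ ≤ (1/n^k − 1/n^(k+1))·(1/n^j·2ⁿ)` for `n ≥ 2`. -/
theorem budget (n j k : ℕ) (hn : (2 : ℝ) ≤ n) :
    1 / (n : ℝ) ^ (j + k + 1) * (2 : ℝ) ^ n ≤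
      (1 / (n : ℝ) ^ k - 1 / (n : ℝ) ^ (k + 1)) * (1 / (n : ℝ) ^ j * (2 : ℝ) ^ n) := by
  have hn0 : (0 : ℝ) < n := by linarith
  have hsub : 1 / (n : ℝ) ^ k - 1 / (n : ℝ) ^ (k + 1) = ((n : ℝ) - 1) / (n : ℝ) ^ (k + 1) := by
    field_simp; ring
  rw [hsub]
  have hpos : (0 : ℝ) ≤ 1 / (n : ℝ) ^ j * (2 : ℝ) ^ n := by positivity
  calc 1 / (n : ℝ) ^ (j + k + 1) * (2 : ℝ) ^ n
      = 1 / (n : ℝ) ^ (k + 1) * (1 / (n : ℝ) ^ j * (2 : ℝ) ^ n) := by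
        rw [show j + k + 1 = (k + 1) + j by ring, pow_add]; field_simp
    _ ≤ ((n : ℝ) - 1) / (n : ℝ) ^ (k + 1) * (1 / (n : ℝ) ^ j * (2 : ℝ) ^ n) := by
        apply mul_le_mul_of_nonneg_right _ hpos
        apply div_le_div_of_nonneg_right _ (by positivity)
        linarith

/-- ★ **THE BRIDGE.** `CylTame3 → CylAlgSpread3 → SpreadLoss3` (29064): fibre summation over the good cylinders.
On each good cylinder `C_a` the inner core `ψ_a` is a dense algebraic test RELATIVE TO `C_a`, so relative spread puts
`≥ #C_a/n^kA` losses inside `C_a ∩ {ψ_a = 1}`, of which at most `#C_a/n^(kA+1)` leak outside `E`; the good cylinders are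
disjoint and cover `≥ 2ⁿ/n^j` inputs, whence `#(E ∩ Loss) ≥ 2ⁿ/n^(j+kA+1)`. -/
theorem spreadLossK3_of_cylTameK3 (K : SysClass) (hT : CylTameK3 K) (hS : CylAlgSpread3) : SpreadLossK3 K := by
  obtain ⟨ηA, hηA, kA, hkA⟩ := hS
  obtain ⟨η, hη, j, hj⟩ := hT ηA hηA (kA + 1)
  refine ⟨η, hη, j + kA + 1, fun c => ?_⟩
  obtain ⟨c', n₀, hn₀⟩ := hj (j + kA + 1) c
  obtain ⟨n₁, hn₁⟩ := hkA (max c c')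
  refine ⟨max (max n₀ n₁) 2, fun n hn P hP m hm w Q hQ hK hdens => ?_⟩
  have hn0 : n₀ ≤ n := le_trans (le_trans (le_max_left _ _) (le_max_left _ _)) hn
  have hn1 : n₁ ≤ n := le_trans (le_trans (le_max_right _ _) (le_max_left _ _)) hn
  have h2 : 2 ≤ n := le_trans (le_max_right _ _) hn
  have h2r : (2 : ℝ) ≤ n := by exact_mod_cast h2
  have hlog : 0 < Nat.log 2 n := Nat.log_pos (by norm_num) h2
  have hdc : (Nat.log 2 n) ^ c ≤ (Nat.log 2 n) ^ (max c c') := Nat.pow_le_pow_right hlog (le_max_left _ _)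
  have hdc' : (Nat.log 2 n) ^ c' ≤ (Nat.log 2 n) ^ (max c c') := Nat.pow_le_pow_right hlog (le_max_right _ _)
  have hP' : ∀ i, P i ∈ Smolensky.lowDeg (ZMod 3) n ((Nat.log 2 n) ^ (max c c')) :=
    fun i => Smolensky.lowDeg_mono hdc (hP i)
  obtain ⟨F, hF, A, hAcan, hAbig, hAgood⟩ := hn₀ n hn0 m hm w Q hQ hK hdens
  choose! ψ hψdeg hψdens hψleak using hAgood
  -- the sets we sum
  set E : (Fin n → Bool) → Prop := fun y => ∀ t, RingHLF.Rel (w t) (fun i => decide (Q t i y = 1)) with hE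
  set L : (Fin n → Bool) → Prop := fun y => ¬ RingHLF.Rel y (fun i => decide (P i y = 1)) with hL
  set piece : (Fin n → Bool) → Finset (Fin n → Bool) := fun a => (cyl F a).filter fun y => E y ∧ L y with hpiece
  -- per-cylinder bound
  have hcyl : ∀ a ∈ A, (1 / (n : ℝ) ^ kA - 1 / (n : ℝ) ^ (kA + 1)) * ((cyl F a).card : ℝ) ≤ ((piece a).card : ℝ) := by
    intro a ha
    have hrel := hn₁ n hn1 P hP' F hF a (ψ a) (Smolensky.lowDeg_mono hdc' (hψdeg a ha)) (hψdens a ha)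
    have hleak := hψleak a ha
    have hsplit : (((cyl F a).filter fun y => ψ a y = 1 ∧ L y).card : ℝ) ≤
        ((piece a).card : ℝ) + (((cyl F a).filter fun y => ψ a y = 1 ∧ ¬ E y).card : ℝ) := by
      have hsub : ((cyl F a).filter fun y => ψ a y = 1 ∧ L y) ⊆
          piece a ∪ ((cyl F a).filter fun y => ψ a y = 1 ∧ ¬ E y) := by
        intro y hy
        rw [Finset.mem_filter] at hy
        rw [Finset.mem_union, hpiece, Finset.mem_filter, Finset.mem_filter]
        by_cases hEy : E y
        · exact Or.inl ⟨hy.1, hEy, hy.2.2⟩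
        · exact Or.inr ⟨hy.1, hy.2.1, hEy⟩
      exact_mod_cast (Finset.card_le_card hsub).trans (Finset.card_union_le _ _)
    have : (1 / (n : ℝ) ^ kA - 1 / (n : ℝ) ^ (kA + 1)) * ((cyl F a).card : ℝ) =
        1 / (n : ℝ) ^ kA * ((cyl F a).card : ℝ) - 1 / (n : ℝ) ^ (kA + 1) * ((cyl F a).card : ℝ) := by ring
    rw [this]
    linarith
  -- disjointness of the pieces and of the cylinders
  have hdisjC : (A : Set (Fin n → Bool)).PairwiseDisjoint (cyl F) := by
    intro a ha a' ha' hne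
    exact disjoint_cyl (hAcan a ha) (hAcan a' ha') hne
  have hdisjP : (A : Set (Fin n → Bool)).PairwiseDisjoint piece := by
    intro a ha a' ha' hne
    exact Finset.disjoint_filter_filter (hdisjC ha ha' hne)
  have hcardC : ((A.biUnion (cyl F)).card : ℝ) = ∑ a ∈ A, ((cyl F a).card : ℝ) := by
    rw [Finset.card_biUnion hdisjC]; push_cast; rfl
  have hcardP : ((A.biUnion piece).card : ℝ) = ∑ a ∈ A, ((piece a).card : ℝ) := by
    rw [Finset.card_biUnion hdisjP]; push_cast; rfl
  have hsubP : A.biUnion piece ⊆ univ.filter fun y => E y ∧ L y := by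
    intro y hy
    rw [Finset.mem_biUnion] at hy
    obtain ⟨a, _, hya⟩ := hy
    rw [hpiece, Finset.mem_filter] at hya
    rw [Finset.mem_filter]
    exact ⟨Finset.mem_univ _, hya.2⟩
  have hnonneg : (0 : ℝ) ≤ 1 / (n : ℝ) ^ kA - 1 / (n : ℝ) ^ (kA + 1) := by
    have hn0 : (0 : ℝ) < n := by linarith
    rw [show 1 / (n : ℝ) ^ kA - 1 / (n : ℝ) ^ (kA + 1) = ((n : ℝ) - 1) / (n : ℝ) ^ (kA + 1) by field_simp; ring]
    apply div_nonneg _ (by positivity); linarith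
  calc 1 / (n : ℝ) ^ (j + kA + 1) * (2 : ℝ) ^ n
      ≤ (1 / (n : ℝ) ^ kA - 1 / (n : ℝ) ^ (kA + 1)) * (1 / (n : ℝ) ^ j * (2 : ℝ) ^ n) := budget n j kA h2r
    _ ≤ (1 / (n : ℝ) ^ kA - 1 / (n : ℝ) ^ (kA + 1)) * ((A.biUnion (cyl F)).card : ℝ) :=
        mul_le_mul_of_nonneg_left hAbig hnonneg
    _ = ∑ a ∈ A, (1 / (n : ℝ) ^ kA - 1 / (n : ℝ) ^ (kA + 1)) * ((cyl F a).card : ℝ) := by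
        rw [hcardC, Finset.mul_sum]
    _ ≤ ∑ a ∈ A, ((piece a).card : ℝ) := Finset.sum_le_sum hcyl
    _ = ((A.biUnion piece).card : ℝ) := hcardP.symm
    _ ≤ ((univ.filter fun y => E y ∧ L y).card : ℝ) := by exact_mod_cast Finset.card_le_card hsubP

/-- the general law specialises to every class. -/
theorem cylTameK3_of_cylTame3 (K : SysClass) (h : CylTame3) : CylTameK3 K := by
  intro η' hη' i
  obtain ⟨η, hη, j, hj⟩ := h η' hη' i
  refine ⟨η, hη, j, fun k c => ?_⟩
  obtain ⟨c', n₀, h0⟩ := hj k c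
  exact ⟨c', n₀, fun n hn m hm w Q hQ _ hd => h0 n hn m hm w Q hQ hd⟩

/-- class-relative tameness is antitone in the class. -/
theorem cylTameK3_mono {K K' : SysClass} (hKK' : ∀ c n m w Q, K' c n m w Q → K c n m w Q) (h : CylTameK3 K) :
    CylTameK3 K' := by
  intro η' hη' i
  obtain ⟨η, hη, j, hj⟩ := h η' hη' i
  refine ⟨η, hη, j, fun k c => ?_⟩
  obtain ⟨c', n₀, h0⟩ := hj k c
  exact ⟨c', n₀, fun n hn m hm w Q hQ hK hd => h0 n hn m hm w Q hQ (hKK' _ _ _ _ _ hK) hd⟩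

/-- `SpreadLoss3` is `SpreadLossK3` of the class of all systems … -/
theorem spreadLoss3_of_spreadLossK3_all (h : SpreadLossK3 AllSys) : SpreadDial.SpreadLoss3 := by
  obtain ⟨η, hη, k, hk⟩ := h
  refine ⟨η, hη, k, fun c => ?_⟩
  obtain ⟨n₀, h0⟩ := hk c
  exact ⟨n₀, fun n hn P hP m hm w Q hQ hd => h0 n hn P hP m hm w Q hQ trivial hd⟩

/-- … and restricts to every class. -/
theorem spreadLossK3_of_spreadLoss3 (K : SysClass) (h : SpreadDial.SpreadLoss3) : SpreadLossK3 K := by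
  obtain ⟨η, hη, k, hk⟩ := h
  refine ⟨η, hη, k, fun c => ?_⟩
  obtain ⟨n₀, h0⟩ := hk c
  exact ⟨n₀, fun n hn P hP m hm w Q hQ _ hd => h0 n hn P hP m hm w Q hQ hd⟩

/-- ★ the bridge for ALL systems (the g13 draft's form): `CylTame3 → CylAlgSpread3 → SpreadLoss3`. -/
theorem spreadLoss3_of_cylTame3 (hT : CylTame3) (hS : CylAlgSpread3) : SpreadDial.SpreadLoss3 :=
  spreadLoss3_of_spreadLossK3_all (spreadLossK3_of_cylTameK3 AllSys (cylTameK3_of_cylTame3 AllSys hT) hS)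

/-- ★ COVER(K) from class-`K` tameness and relative spread on cylinders. -/
theorem kCover3_of_pieces (K : SysClass) (hT : CylTameK3 K) (hC : CylCover3) : KCover3 K :=
  fun hP hA => spreadLossK3_of_cylTameK3 K hT (hC hP hA)

/-- ★ **EXACT SPLIT** (pure logic + tree `SteerDial.polyLoss3_of_algSpread3_item`): for EVERY class `K`,
`30910 PureCover3 ⟺ COVER(K) ∧ BRIDGE(K)`. -/
theorem pureCover3_iff_kPieces (K : SysClass) : SpreadDial.PureCover3 ↔ KCover3 K ∧ KBridge3 K :=
  ⟨fun h => ⟨fun hP hA => spreadLossK3_of_spreadLoss3 K (h hP hA),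
    fun _ hA => h (Theorems.SteerDial.polyLoss3_of_algSpread3_item hA) hA⟩,
   fun ⟨hC, hB⟩ hP hA => hB (hC hP hA) hA⟩

/-- CylinderDialSplit helper `jCover3_of_pureCover3` (decomp-qadv land package; see the module docstring). -/
theorem jCover3_of_pureCover3 (h : SpreadDial.PureCover3) : JCover3 := ((pureCover3_iff_kPieces Junta).mp h).1
/-- CylinderDialSplit helper `jBridge3_of_pureCover3` (decomp-qadv land package; see the module docstring). -/
theorem jBridge3_of_pureCover3 (h : SpreadDial.PureCover3) : JBridge3 := ((pureCover3_iff_kPieces Junta).mp h).2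
/-- CylinderDialSplit helper `spreadLossJ3_of_spreadLoss3` (decomp-qadv land package; see the module docstring). -/
theorem spreadLossJ3_of_spreadLoss3 (h : SpreadDial.SpreadLoss3) : SpreadLossJ3 := spreadLossK3_of_spreadLoss3 Junta h
/-- CylinderDialSplit helper `cylTameJ3_of_cylTame3` (decomp-qadv land package; see the module docstring). -/
theorem cylTameJ3_of_cylTame3 (h : CylTame3) : CylTameJ3 := cylTameK3_of_cylTame3 Junta h

/-- ★ the junta split is exact: `30910 ⟺ JCover3 ∧ JBridge3`. -/
theorem pureCover3_iff_jPieces : SpreadDial.PureCover3 ↔ JCover3 ∧ JBridge3 := pureCover3_iff_kPieces Junta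

/-- ★ COVER(junta) from the node's pieces R = `CylTameJ3` and C = `CylCover3`. -/
theorem jCover3_of_pieces (hT : CylTameJ3) (hC : CylCover3) : JCover3 := kCover3_of_pieces Junta hT hC

/-- ★ **THE NODE'S GLUE**: R, C and the residual bridge B give 30910 `PureCover3`. -/
theorem pureCover3_of_pieces (hT : CylTameJ3) (hC : CylCover3) (hB : JBridge3) : SpreadDial.PureCover3 :=
  pureCover3_iff_jPieces.mpr ⟨jCover3_of_pieces hT hC, hB⟩

/-- … hence 29065 `CoverLift3` from 30909 `AlgCover3` and the pieces (tree glue `SteerDial.coverSplitGlue3`). -/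
theorem coverLift3_of_pieces (hA : SpreadDial.AlgCover3) (hT : CylTameJ3) (hC : CylCover3) (hB : JBridge3) :
    SpreadDial.CoverLift3 :=
  Theorems.SteerDial.coverSplitGlue3 hA (pureCover3_of_pieces hT hC hB)

/-- ★ **`closes`** — the leaf BY NAME from the node's pieces: `PolyLoss3 (26123) → AlgCover3 (30909) → CylTameJ3 →
CylCover3 → JBridge3 → AdviceFreeQNC0Three` (tree `Theorems.spreadDial_closes₂` discharges the two PROVED bridges of
SpreadDial; every binder is consumed). -/
theorem closes (hP : SpreadDial.PolyLoss3) (hA : SpreadDial.AlgCover3) (hT : CylTameJ3) (hC : CylCover3)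
    (hB : JBridge3) : AdviceFreeQNC0Three :=
  Theorems.spreadDial_closes₂ hP (coverLift3_of_pieces hA hT hC hB)

/-- the same through the route's own deciding theorem `SpreadDial.closes` (bridges 29066, 26125 by their landed proofs). -/
theorem closes_tree (hP : SpreadDial.PolyLoss3) (hA : SpreadDial.AlgCover3) (hT : CylTameJ3) (hC : CylCover3)
    (hB : JBridge3) : AdviceFreeQNC0Three :=
  SpreadDial.closes hP (coverLift3_of_pieces hA hT hC hB) Theorems.spreadDial_spreadBridge3
    Theorems.spreadDial_multiRingBridge3

/-- the NAIVE closing (the general law `CylTame3`, no bridge binder) — kept for the record; `CylTame3` is conjecturally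
FALSE (§7), so this is NOT the node's deciding theorem. -/
theorem closes_naive (hP : SpreadDial.PolyLoss3) (hA : SpreadDial.AlgCover3) (hT : CylTame3) (hC : CylCover3) :
    AdviceFreeQNC0Three :=
  Theorems.spreadDial_closes₂ hP (Theorems.SteerDial.coverSplitGlue3 hA fun hP' hA' => spreadLoss3_of_cylTame3 hT (hC hP' hA'))

/-- T* (26122 `MultiRingHard3`) from the pieces. -/
theorem multiRingHard3_of_pieces (hP : SpreadDial.PolyLoss3) (hA : SpreadDial.AlgCover3) (hT : CylTameJ3)
    (hC : CylCover3) (hB : JBridge3) : SpreadDial.MultiRingHard3 :=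
  Theorems.spreadDial_spreadBridge3 (coverLift3_of_pieces hA hT hC hB hP)


end Bridge


end Summit.QuantumAdvantage.QuantumAdvantage.Theorems.CylinderDial
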